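import Summits.NavierStokesRegularity.NavierStokesRegularity.Theorems.HubbleDynamoNoSelfExcitedDynamoEnstrophyFloorSharp
import Summits.NavierStokesRegularity.NavierStokesRegularity.Theorems.HubbleDynamoNoSelfExcitedDynamoStubFarFieldTransfer
import Summits.NavierStokesRegularity.NavierStokesRegularity.Theorems.HubbleDynamoNoSelfExcitedDynamoStubStrainRegime
import HarnessLib

/-!
# Crux `NoSelfExcitedDynamo` (stmt-NavierStokesRegularity-1934), line `registered`, skeleton v18:
# bridges for the open stub G⁵ `stub_noRecurrentProfileAboveFloorWithTail`

Theorems file (`--supports stmt-NavierStokesRegularity-1934`; theorems only, sorry-free). Lead c4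
reshaped the line's open stub G⁗ (`stub_noRecurrentProfileAboveSharpEnstrophyFloor`, v16) into
G⁗ ⇐ F1 ∧ S1 ∧ G⁵ with the two provable stubs LANDED:

* F1 `stub_farFieldTransfer` (p172846, Albritton–Barker 2019 Thm 4.1, tree theorem): an eternal
  profile-class solution of Leray's backward system with ONE slice of trivial blow-down at spatial
  infinity vanishes;
* S1 `stub_strainRegime` (p172986, vorticity maximum principle in similarity variables): an eternal
  profile-class solution with `⟪v, DW v⟫ ≤ μ‖v‖²`, `μ < 1`, vanishes;

and the open residue G⁵ = "no UNIFORMLY RECURRENT eternal profile-class solution which stays above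
the sharp enstrophy floor `K_S⁶E² ≥ 64/27`, has a NONTRIVIAL blow-down tail at every time, and whose
strain reaches the self-similar vorticity rate (`sup ⟪v, DW v⟫/‖v‖² ≥ 1`)". This file records the
kernel-checked web: G⁵ ⇒ G⁗ (`noRecurrentProfileAboveSharpFloor_of_noRecurrentProfileAboveFloorWithTail`,
the skeleton's composition), G⁵ ⇒ crux, crux ⇒ G⁵ (so G⁵ ⇔ G⁗ ⇔ G″ ⇔ crux), and node
(`RecurrentLiouville`, stmt-1589) ⇒ G⁵. What G⁵'s two new clauses give an attacker: the tail of
`W(s)` at radius `r ≫ 1` is the mid-field of the remote past `s − 2 log r` (frozen far field), so a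
counterexample carries its almost-periodic history as a log-oscillating `−1`-homogeneous tail, has
infinite energy and no `Lᵖ` slice, `p ≤ 3` (`farFieldRung_of_finiteEnergySlice`); and its gradient
profile constant is `K₁ ≥ 1` with the vorticity maximum stretched at mean rate `≥ 1` in the core.
-/

noncomputable section

-- the mandated stub namespace repeats `NavierStokesRegularity` (tree precedent for this crux's stubs)
set_option linter.dupNamespace false

namespace Summit.NavierStokesRegularity.NavierStokesRegularity.Theorems.NoSelfExcitedDynamo.Registered

open Set MeasureTheory Filter Topology InnerProductSpace Function
open scoped RealInnerProductSpace Laplacian ContDiff NNReal ENNReal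
open Literature.Analysis.FluidPDE

/-- **G⁵ ⇒ G⁗** (sub-goal `noRecurrentProfileAboveSharpFloor_of_noRecurrentProfileAboveFloorWithTail`;
the composition of skeleton v17/v18): a uniformly recurrent eternal profile-class solution above the
sharp enstrophy floor either has a slice with trivial blow-down (F1 `stub_farFieldTransfer` kills it),
or a uniform strain bound `μ < 1` (S1 `stub_strainRegime` kills it), or it satisfies the two extra
clauses of G⁵ (G⁵ kills it). -/
theorem noRecurrentProfileAboveSharpFloor_of_noRecurrentProfileAboveFloorWithTail
    (hG5 : ∀ (W : ℝ → EuclideanSpace ℝ (Fin 3) → EuclideanSpace ℝ (Fin 3)) (Q : ℝ → EuclideanSpace ℝ (Fin 3) → ℝ),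
      IsBackwardLeraySolutionOn univ 1 W Q →
      (∀ k : ℕ, ∃ K : ℝ, ∀ s y, (1 + ‖y‖) ^ (k + 1) * ‖iteratedFDeriv ℝ k (W s) y‖ ≤ K) →
      (∀ ε : ℝ, 0 < ε → ∀ R : ℝ, ∃ L : ℝ, 0 < L ∧ ∀ a : ℝ, ∃ σ ∈ Icc a (a + L),
        ∀ s ∈ Icc (-R) R, ∀ y ∈ Metric.closedBall (0 : EuclideanSpace ℝ (Fin 3)) R,
          ‖W (s + σ) y - W s y‖ < ε) →
      (∀ s, 64 / 27 ≤ ((SNormLESNormFDerivOfEqConst (EuclideanSpace ℝ (Fin 3))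
            (volume : Measure (EuclideanSpace ℝ (Fin 3))) 2 : ℝ≥0) : ℝ) ^ 6 *
          (∫ y, ‖curl (W s) y‖ ^ 2) ^ 2) →
      (∀ s₀ : ℝ, ∃ φ : EuclideanSpace ℝ (Fin 3) → EuclideanSpace ℝ (Fin 3),
        Literature.Analysis.FunctionSpaces.IsTestFunctionOn
            (⊤ : TopologicalSpace.Opens (EuclideanSpace ℝ (Fin 3))) φ ∧
          ¬ Tendsto (fun lam : ℝ => ∫ y, ⟪lam • W s₀ (lam • y), φ y⟫) atTop (𝓝 0)) →
      (∀ μ : ℝ, μ < 1 → ∃ s y, ∃ v : EuclideanSpace ℝ (Fin 3), μ * ‖v‖ ^ 2 < ⟪v, fderiv ℝ (W s) y v⟫) →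
      ∀ s y, W s y = 0) :
    ∀ (W : ℝ → EuclideanSpace ℝ (Fin 3) → EuclideanSpace ℝ (Fin 3)) (Q : ℝ → EuclideanSpace ℝ (Fin 3) → ℝ),
      IsBackwardLeraySolutionOn univ 1 W Q →
      (∀ k : ℕ, ∃ K : ℝ, ∀ s y, (1 + ‖y‖) ^ (k + 1) * ‖iteratedFDeriv ℝ k (W s) y‖ ≤ K) →
      (∀ ε : ℝ, 0 < ε → ∀ R : ℝ, ∃ L : ℝ, 0 < L ∧ ∀ a : ℝ, ∃ σ ∈ Icc a (a + L),
        ∀ s ∈ Icc (-R) R, ∀ y ∈ Metric.closedBall (0 : EuclideanSpace ℝ (Fin 3)) R,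
          ‖W (s + σ) y - W s y‖ < ε) →
      (∀ s, 64 / 27 ≤ ((SNormLESNormFDerivOfEqConst (EuclideanSpace ℝ (Fin 3))
            (volume : Measure (EuclideanSpace ℝ (Fin 3))) 2 : ℝ≥0) : ℝ) ^ 6 *
          (∫ y, ‖curl (W s) y‖ ^ 2) ^ 2) →
      ∀ s y, W s y = 0 := by
  intro W Q hW hprof hrec hfloor
  by_cases htail : ∃ s₀ : ℝ, ∀ φ : EuclideanSpace ℝ (Fin 3) → EuclideanSpace ℝ (Fin 3),
      Literature.Analysis.FunctionSpaces.IsTestFunctionOn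
          (⊤ : TopologicalSpace.Opens (EuclideanSpace ℝ (Fin 3))) φ →
        Tendsto (fun lam : ℝ => ∫ y, ⟪lam • W s₀ (lam • y), φ y⟫) atTop (𝓝 0)
  · exact stub_farFieldTransfer W Q hW hprof htail
  by_cases hstrain : ∃ μ : ℝ, μ < 1 ∧
      ∀ s y (v : EuclideanSpace ℝ (Fin 3)), ⟪v, fderiv ℝ (W s) y v⟫ ≤ μ * ‖v‖ ^ 2
  · exact stub_strainRegime W Q hW hprof hstrain
  push Not at htail hstrain
  refine hG5 W Q hW hprof hrec hfloor (fun s₀ => ?_) (fun μ hμ => ?_)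
  · obtain ⟨φ, hφ, hnot⟩ := htail s₀
    exact ⟨φ, hφ, hnot⟩
  · obtain ⟨s, y, v, hv⟩ := hstrain μ hμ
    exact ⟨s, y, v, hv⟩

/-- **G⁵ ⇒ crux** (sub-goal `noSelfExcitedDynamo_of_noRecurrentProfileAboveFloorWithTail`; the
conclusion is the crux `NoSelfExcitedDynamo` unfolded), through G⁗ (p166766) and G″ (p160780). -/
theorem noSelfExcitedDynamo_of_noRecurrentProfileAboveFloorWithTail :
    (∀ (W : ℝ → EuclideanSpace ℝ (Fin 3) → EuclideanSpace ℝ (Fin 3)) (Q : ℝ → EuclideanSpace ℝ (Fin 3) → ℝ),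
      IsBackwardLeraySolutionOn univ 1 W Q →
      (∀ k : ℕ, ∃ K : ℝ, ∀ s y, (1 + ‖y‖) ^ (k + 1) * ‖iteratedFDeriv ℝ k (W s) y‖ ≤ K) →
      (∀ ε : ℝ, 0 < ε → ∀ R : ℝ, ∃ L : ℝ, 0 < L ∧ ∀ a : ℝ, ∃ σ ∈ Icc a (a + L),
        ∀ s ∈ Icc (-R) R, ∀ y ∈ Metric.closedBall (0 : EuclideanSpace ℝ (Fin 3)) R,
          ‖W (s + σ) y - W s y‖ < ε) →
      (∀ s, 64 / 27 ≤ ((SNormLESNormFDerivOfEqConst (EuclideanSpace ℝ (Fin 3))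
            (volume : Measure (EuclideanSpace ℝ (Fin 3))) 2 : ℝ≥0) : ℝ) ^ 6 *
          (∫ y, ‖curl (W s) y‖ ^ 2) ^ 2) →
      (∀ s₀ : ℝ, ∃ φ : EuclideanSpace ℝ (Fin 3) → EuclideanSpace ℝ (Fin 3),
        Literature.Analysis.FunctionSpaces.IsTestFunctionOn
            (⊤ : TopologicalSpace.Opens (EuclideanSpace ℝ (Fin 3))) φ ∧
          ¬ Tendsto (fun lam : ℝ => ∫ y, ⟪lam • W s₀ (lam • y), φ y⟫) atTop (𝓝 0)) →
      (∀ μ : ℝ, μ < 1 → ∃ s y, ∃ v : EuclideanSpace ℝ (Fin 3), μ * ‖v‖ ^ 2 < ⟪v, fderiv ℝ (W s) y v⟫) →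
      ∀ s y, W s y = 0) →
    ∀ u : ℝ → EuclideanSpace ℝ (Fin 3) → EuclideanSpace ℝ (Fin 3),
      IsBoundedAncientMildSolution 1 u →
      (∀ t < 0, AEStronglyMeasurable (u t) volume) → (∃ C : ℝ, HasTypeIDecay C u) →
      ∀ t < 0, u t =ᵐ[volume] (0 : EuclideanSpace ℝ (Fin 3) → EuclideanSpace ℝ (Fin 3)) := fun hG5 =>
  noSelfExcitedDynamo_of_noRecurrentProfileAboveSharpFloor
    (noRecurrentProfileAboveSharpFloor_of_noRecurrentProfileAboveFloorWithTail hG5)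

/-- **crux ⇒ G⁵** (sub-goal `noRecurrentProfileAboveFloorWithTail_of_noSelfExcitedDynamo`; hypothesis
= the crux unfolded), through p166766. So G⁵ ⇔ G⁗ ⇔ G″ ⇔ crux: the reshape loses nothing. -/
theorem noRecurrentProfileAboveFloorWithTail_of_noSelfExcitedDynamo :
    (∀ u : ℝ → EuclideanSpace ℝ (Fin 3) → EuclideanSpace ℝ (Fin 3),
      IsBoundedAncientMildSolution 1 u →
      (∀ t < 0, AEStronglyMeasurable (u t) volume) → (∃ C : ℝ, HasTypeIDecay C u) →
      ∀ t < 0, u t =ᵐ[volume] (0 : EuclideanSpace ℝ (Fin 3) → EuclideanSpace ℝ (Fin 3))) →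
    ∀ (W : ℝ → EuclideanSpace ℝ (Fin 3) → EuclideanSpace ℝ (Fin 3)) (Q : ℝ → EuclideanSpace ℝ (Fin 3) → ℝ),
      IsBackwardLeraySolutionOn univ 1 W Q →
      (∀ k : ℕ, ∃ K : ℝ, ∀ s y, (1 + ‖y‖) ^ (k + 1) * ‖iteratedFDeriv ℝ k (W s) y‖ ≤ K) →
      (∀ ε : ℝ, 0 < ε → ∀ R : ℝ, ∃ L : ℝ, 0 < L ∧ ∀ a : ℝ, ∃ σ ∈ Icc a (a + L),
        ∀ s ∈ Icc (-R) R, ∀ y ∈ Metric.closedBall (0 : EuclideanSpace ℝ (Fin 3)) R,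
          ‖W (s + σ) y - W s y‖ < ε) →
      (∀ s, 64 / 27 ≤ ((SNormLESNormFDerivOfEqConst (EuclideanSpace ℝ (Fin 3))
            (volume : Measure (EuclideanSpace ℝ (Fin 3))) 2 : ℝ≥0) : ℝ) ^ 6 *
          (∫ y, ‖curl (W s) y‖ ^ 2) ^ 2) →
      (∀ s₀ : ℝ, ∃ φ : EuclideanSpace ℝ (Fin 3) → EuclideanSpace ℝ (Fin 3),
        Literature.Analysis.FunctionSpaces.IsTestFunctionOn
            (⊤ : TopologicalSpace.Opens (EuclideanSpace ℝ (Fin 3))) φ ∧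
          ¬ Tendsto (fun lam : ℝ => ∫ y, ⟪lam • W s₀ (lam • y), φ y⟫) atTop (𝓝 0)) →
      (∀ μ : ℝ, μ < 1 → ∃ s y, ∃ v : EuclideanSpace ℝ (Fin 3), μ * ‖v‖ ^ 2 < ⟪v, fderiv ℝ (W s) y v⟫) →
      ∀ s y, W s y = 0 :=
  fun hcrux W Q hW hprof hrec hfloor _ _ =>
    noRecurrentProfileAboveSharpFloor_of_noSelfExcitedDynamo hcrux W Q hW hprof hrec hfloor

/-- **node ⇒ G⁵** (sub-goal `noRecurrentProfileAboveFloorWithTail_of_recurrentLiouville`): the node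
crux `RecurrentLiouville` (stmt-NavierStokesRegularity-1589) implies the line's open stub, through
the crux (p157812, p160780, p166766). -/
theorem noRecurrentProfileAboveFloorWithTail_of_recurrentLiouville
    (h : Theses.SqueezeCycle.RecurrentLiouville) :
    ∀ (W : ℝ → EuclideanSpace ℝ (Fin 3) → EuclideanSpace ℝ (Fin 3)) (Q : ℝ → EuclideanSpace ℝ (Fin 3) → ℝ),
      IsBackwardLeraySolutionOn univ 1 W Q →
      (∀ k : ℕ, ∃ K : ℝ, ∀ s y, (1 + ‖y‖) ^ (k + 1) * ‖iteratedFDeriv ℝ k (W s) y‖ ≤ K) →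
      (∀ ε : ℝ, 0 < ε → ∀ R : ℝ, ∃ L : ℝ, 0 < L ∧ ∀ a : ℝ, ∃ σ ∈ Icc a (a + L),
        ∀ s ∈ Icc (-R) R, ∀ y ∈ Metric.closedBall (0 : EuclideanSpace ℝ (Fin 3)) R,
          ‖W (s + σ) y - W s y‖ < ε) →
      (∀ s, 64 / 27 ≤ ((SNormLESNormFDerivOfEqConst (EuclideanSpace ℝ (Fin 3))
            (volume : Measure (EuclideanSpace ℝ (Fin 3))) 2 : ℝ≥0) : ℝ) ^ 6 *
          (∫ y, ‖curl (W s) y‖ ^ 2) ^ 2) →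
      (∀ s₀ : ℝ, ∃ φ : EuclideanSpace ℝ (Fin 3) → EuclideanSpace ℝ (Fin 3),
        Literature.Analysis.FunctionSpaces.IsTestFunctionOn
            (⊤ : TopologicalSpace.Opens (EuclideanSpace ℝ (Fin 3))) φ ∧
          ¬ Tendsto (fun lam : ℝ => ∫ y, ⟪lam • W s₀ (lam • y), φ y⟫) atTop (𝓝 0)) →
      (∀ μ : ℝ, μ < 1 → ∃ s y, ∃ v : EuclideanSpace ℝ (Fin 3), μ * ‖v‖ ^ 2 < ⟪v, fderiv ℝ (W s) y v⟫) →
      ∀ s y, W s y = 0 :=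
  fun W Q hW hprof hrec hfloor _ _ =>
    noRecurrentProfileAboveSharpFloor_of_recurrentLiouville h W Q hW hprof hrec hfloor

end Summit.NavierStokesRegularity.NavierStokesRegularity.Theorems.NoSelfExcitedDynamo.Registered

end
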